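import Literature.MathematicalPhysics.QuantumLattice.HubbardChainEnergyDensity
import Literature.MathematicalPhysics.QuantumLattice.HubbardChainEnergyDensityAt
import Literature.MathematicalPhysics.QuantumLattice.HubbardTorus2DEnergyDensity
import Literature.MathematicalPhysics.QuantumLattice.HubbardNNNHoppingThermodynamicLimit
import Literature.Analysis.FunctionSpaces.LiebWuIntegrals
import Literature.MathematicalPhysics.QuantumLattice.HubbardCorrelatorCertificateAffine
import Literature.MathematicalPhysics.QuantumLattice.HubbardNNNHoppingCorrelatorWindowCertificate

/-!
# Ventures/CertifiedManyBodySolver — Statement (STUB v3 = typed companion of STATEMENT-DRAFT-v1.md; lead gen-3 2026-08-20T19:49:07Z for the scribe to adopt; lit-4 energy rows + scribe §S unchanged in meaning)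

HONEST FRAMING: first certified bounds; not a superconductivity verdict; every number certified or
labelled float.

WHAT THIS FILE IS. The venture's typed statement is a list of ROW PREDICATES with explicit rational slots
(BOARD.md D-8 / VENTURE-STATEMENT §Typed statement): `…LowerRow … lo` says `lo ≤ <tree TL object>`, `…UpperRow … hi`
says `<object> ≤ hi`; correlator rows carry their energy hypothesis explicitly (D-4). NOTHING IS ASSERTED HERE: a row is
instantiated only by a file under `Certificates/` that proves it from a certificate (sha256 in its docstring) through a
named tree soundness theorem. The width predicates (`M1Width`, `M2Width`, `M3Width`) are REPORTING THRESHOLDS on the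
slots — M1: 1e-3·t OF RECORD (`M1Width`) with 1e-4·t as declared STRETCH (`M1WidthStretch`); M2: 0.02·t; M3′: 0.05·t —
fixed by the COORDINATOR RULING 2026-08-20T19:52Z adopting tribunal T1's retarget (STATEMENT-DRAFT-v1.md), never claims. Bracket-existence statements (`∃ lo hi, …`) are deliberately absent (D-8:
true by density of ℚ, vacuous).

TRIBUNAL RECORD (run/shared/lean/pub/pub-mbsolver/tribunal/): T1 (t1.md, 2026-08-20T19:36Z) verdict hollow-above:M2 —
M1 honest calibration, M2 needs a tolerance (≤ 0.02·t proposed) + TL S(π,π), M3–M6 summit-strength as worded; retarget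
M3′ = certified two-sided e₀ at (U=8, δ=1/8, t′ ∈ {0, −1/4}) to width ≤ 0.05·t + certified ONE-SIDED TL upper bounds on the
d-wave pair structure factor / |P_d(r)|; M5′ no-ranking. T2 (t2.json, 2026-08-20T19:45Z): certification (A) and certified
uppers (B) are in print and in-house; the genuinely unprinted artefact is certified TL pairing/stripe correlator bounds,
"likely first deliverable a certified NON-separating pair of intervals". The cell's readings R-10/R-11 (VENTURE-STATEMENT
[v1.4]) adopt M3′ as the working M3 target and forbid any phase sentence (R-6: only "the certified intervals do / do not
overlap"). The predicates below are tolerance-free and survive any retarget; J / T3–T5 may still annotate.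

## Target (what the venture builds)
A CERTIFIED MANY-BODY SOLVER for Hubbard-type lattice models: for a stated Hamiltonian H (lattice, boundary/thermodynamic-limit formulation, U/t, t′/t, filling), produce
 (L) a rigorous LOWER bound on the ground-state energy density e₀(H) — and rigorous bounds on stated ground-state correlation functions — from SEMIDEFINITE BOOTSTRAP relaxations: positivity of reduced-density-matrix / operator moment matrices ⟨O_i† O_j⟩ over a symmetry-reduced operator basis (translation, point group, spin SU(2), particle-hole where present, U(1) charge), the Hamiltonian/equation-of-motion constraints ⟨[H,O]⟩ = 0, and (thermodynamic limit) translation-invariance/clustering constraints; solved as an SDP by the fleet's signed engines (certsdp / SOS engines) and made RIGOROUS by rational rounding of the dual and interval (Arb) verification that the rounded dual functional is feasible — the certificate is the rounded dual + its verification log, valid for H exactly;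
 (U) a rigorous UPPER bound e₀(H) ≤ ⟨ψ|H|ψ⟩/⟨ψ|ψ⟩ from an explicit variational state ψ (DMRG/MPS, VMC/Jastrow–Slater, PEPS/tensor network) whose energy — and the same correlation functions — are evaluated in INTERVAL ARITHMETIC (or exactly) for the stated finite system / with a stated, proved finite-size-to-thermodynamic-limit correction; the certificate is ψ's parameters + the interval evaluation log;
 and SQUEEZE: report [L, U] per quantity with both certificates; a rung is REACHED only when a cross-family referee re-verifies both certificates from the files (not from the seat's word) and the width meets the rung's tolerance. Correlation-function bounds use the standard linear-functional-over-the-feasible-set form (min/max of ⟨O⟩ subject to the same SDP constraints ∧ energy ≤ U), so they inherit rigor from (L) and (U).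

## Ladder v1 (COORDINATOR RULING 2026-08-20T19:52Z adopting tribunal T1's retarget; these are the WORKING NUMBERS OF RECORD for every seat; v0 text in the Appendix)
- M1 — 1D HUBBARD CALIBRATION (the venture's STEP-0): certified two-sided bounds [L, U] on e₀(U/t) of the one-dimensional Hubbard model at half filling, thermodynamic limit, at U/t ∈ {1, 2, 4, 8}, with |U − L| ≤ 1e-3·t (TOLERANCE OF RECORD; 1e-4·t is the declared STRETCH target and is reported against, never required), reproducing the Lieb–Wu value (which must fall inside [L, U] — under the tree's named fact `lieb_wu` this is a theorem about the bracket, and a failure is an EVENT); plus at least one doped filling (density-n thermodynamic-limit object = the ring limit `hubbardChainEnergyDensityAt`, tree, p233958) with its width reported; plus certified bounds on the nearest-neighbour spin correlation and the double occupancy at the same points (correlator bounds are linear functionals over the SDP feasible set ∧ energy ≤ a CERTIFIED upper, so they are conditional on nothing uncertified). Calibration: the exact answer is known; the rung measures the machinery (operator-basis size, SDP size, rounding loss, interval width, cost law) and every later number is conditioned on it.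
- M2 — 2D HALF FILLING vs SIGN-FREE QMC: certified thermodynamic-limit two-sided e₀ width ≤ 0.02·t for the square-lattice Hubbard model at half filling at EACH of U/t ∈ {2, 4, 6, 8} — a row that does not beat the existing in-house certified widths (pub-mbboot: 0.087 / 0.126 / 0.130 / 0.117·t at U = 2/4/6/8, AFQMC inside) is NOT an M2 result; plus certified thermodynamic-limit bounds on the staggered spin structure factor S(π,π) and/or the nearest-neighbour spin correlation C_nn (finite-torus S(π,π) rows are admissible only labelled as torus rows with a stated, proved torus→TL statement or none); published sign-problem-free AFQMC/DQMC values must fall inside [L, U] (a falsification test under a pre-registered key/convention grammar, not an input).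
- M3′ — DOPED 2D SINGLE BAND, CERTIFIED ENERGY BRACKET + ONE-SIDED CORRELATOR UPPER BOUNDS (retargeted from v0 M3 by T1; coordinate with pub-hubbard, do not fork): at U = 8t, hole doping δ = 1/8, t′ = 0 AND t′/t = −0.25: (a) certified two-sided e₀ width ≤ 0.05·t at BOTH t′ (this rigorously beats the best printed floating-point SDP lower bound, Han 2020 K = 7, which sits 0.10·t above e₀); (b) certified ONE-SIDED thermodynamic-limit UPPER bounds on the d-wave pair structure factor and/or |P_d(r)| at stated distances, at a STATED moment level (operator basis, window/cluster, symmetry reductions, energy window used), at both t′. The deliverable is the pair of certified objects with and without t′, stated neutrally; the ONLY admissible comparison sentence is 'the certified intervals at t′ = 0 and t′ = −1/4 do / do not overlap' — never a phase sentence, never a statement about the Hubbard dichotomy.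
- HORIZON (declared open-physics horizon, NOT a rung): M3 DISCRIMINATION — separating the t′ = 0 and t′ = −0.25 ground states by certified correlator or energy intervals requires widths ≤ 0.005·t, because the competing orders at (U = 8, δ = 1/8) are split by 0.0005–0.009·t (uniform d-wave vs filled stripe ≈ 0.009·t; stripe wavelengths λ = 5…8 within 0.0005–0.004·t; Zheng et al. Science 358 (2017) 1155 = arXiv:1701.00054 p.4–5, SM Tab. S1; Qin et al. PRX 10 (2020) 031016 = arXiv:1910.08931 p.8). ≤ 0.005·t is the DAY-7 SCALING-VERDICT YARDSTICK: the venture reports the measured law 'certified width vs cost' per family and the extrapolated cost to reach 0.005·t at the M3 point — honestly, whichever way it comes out.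
- M4′ — THREE-BAND EMERY MODEL: the M3′ quantities with the M3′ tolerances (certified e₀ width ≤ 0.05 in the model's hopping unit; one-sided pair-structure-factor uppers at a stated level) for the CuO₂ three-band (Emery) model at a stated published parameter set (ε_d − ε_p, t_pd, t_pp, U_d, U_p) and δ = 1/8.
- M5′ — RETROSPECTIVE TABLE (no ranking claim): for ~10 published DOWNFOLDED Hamiltonians of known superconductors and ~10 of non-superconducting structural/chemical neighbours (parameters verbatim from print, cited), the certified table of e₀ brackets and one-sided pairing-structure-factor upper bounds per Hamiltonian; NO ranking statistic is computed or claimed until the certified widths justify one (pre-registered rule: a ranking is attempted only if the median certified width is below a pre-registered inter-group spread; otherwise the table is the result).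
- M6 — PROSPECTIVE: the M5′ protocol applied to proposed compositions' published downfolded Hamiltonians; plan only, conditional on M5′; output = certified table, explicitly NOT a prediction of T_c.
(v0 rung text, operator 2026-08-20T18:28Z: run/shared/lean/pub/pub-mbsolver/STATEMENT-DRAFT.md §Ladder = STATEMENT-DRAFT-v1.md Appendix.)

READINGS of the rungs (binding for every row): HOME/VENTURE-STATEMENT.md §Readings R-1…R-11 and §Certified [v1.3]/[v1.4]
(speedrun cell sr-mbsolver, run/shared/lean/speedrun/mbsolver/). Tree objects used: HOME/lean/LEAN-MAP.md §1–§3 (energy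
rows, lit-4) and §S (correlator / falsification rows, scribe). Doped-chain rows use `hubbardChainEnergyDensityAt` (p233958 ACCEPTED
2026-08-20T19:46Z): `M1DopedEnergy{Lower,Upper}Row U p q` (lit-4's planned name; transport BOARD D-13 r17).

Change log (single file, two writers — lit-4: energy-row predicates + decl correctness; scribe: module
docstring + §S; every edit appends a line here):
- 2026-08-20T19:07Z scribe g1: v0 skeleton; 19:10Z scribe g1: v1 per D-8 (sha 02895f15…).
- 2026-08-20T19:13Z lit-4: v0 of THIS file (energy rows in the literal binder shapes of the tree; replaced v1 in place).
- 2026-08-20T19:31:11Z scribe g2: v2 = lit-4 v0 UNCHANGED + §S re-added below it (chain / square torus-limit correlator rows in the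
  verbatim binder shape of the substrate claim nodes `sdp_corr_TL_*` = conclusion shape of
  `InfVolFermionState.IsTorusLimitOf.re_expect_ge_of_chain_window_certificate_ineq` / `…_of_window_certificate_d4_ineq`;
  M3 correlator rows over FINITE tori as orbit-state rows, conclusion shape of
  `re_orbitState_ge_of_window_certificate_d4_TT'_groundState` (LEAN-MAP §3.4, D-8 last bullet); docc word; `RefIntervalInside`).
- 2026-08-20T19:49:07Z / 19:58Z lead gen-3: v3 (BOARD D-14/D-15; COORDINATOR RULING 19:52Z ⇒ `M1Width` 1e-3 + `M1WidthStretch` 1e-4,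
  Ladder v1 in this docstring = STATEMENT-DRAFT-v1.md): docstring = framing + policy + tribunal record + §Target verbatim + Ladder v1; ONE-SIDED energy predicates `M{1,2,3}Energy{Lower,Upper}Row` + `_iff` with the two-sided rows (bodies of lit-4's
  rows unchanged); `M2Width`/`M3Width`; `M1DopedEnergy{Lower,Upper}Row` over `hubbardChainEnergyDensityAt` (p233958); smoke tests deleted. Scribe adopts into Statement.draft.lean (scribe stays the writer).
-/

noncomputable section

namespace Summit.Ventures.CertifiedManyBodySolver

open Literature.MathematicalPhysics.QuantumLattice
open Literature.MathematicalPhysics.QuantumLattice.ThermodynamicLimit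
open Literature.Analysis.FunctionSpaces

/-- M1 energy row: a certified bracket `lo ≤ e₀(U) ≤ hi` for the half-filled Hubbard chain (t = 1) in the
thermodynamic limit (`hubbardChainEnergyDensity`, LEAN-MAP §1.1). -/
def M1EnergyRow (U : ℝ) (lo hi : ℚ) : Prop :=
  ((lo : ℚ) : ℝ) ≤ hubbardChainEnergyDensity 1 U ∧ hubbardChainEnergyDensity 1 U ≤ ((hi : ℚ) : ℝ)

/-- One-sided M1 rows (today's certificates are one-sided; a LOWER row is a certified `lo ≤ e₀(U)`, an UPPER row a
certified `e₀(U) ≤ hi`, same TL object as `M1EnergyRow`). -/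
def M1EnergyLowerRow (U : ℝ) (lo : ℚ) : Prop := ((lo : ℚ) : ℝ) ≤ hubbardChainEnergyDensity 1 U

/-- M1 UPPER energy row: a certified `e₀(U) ≤ hi` (half-filled chain, TL). -/
def M1EnergyUpperRow (U : ℝ) (hi : ℚ) : Prop := hubbardChainEnergyDensity 1 U ≤ ((hi : ℚ) : ℝ)

/-- The two-sided M1 row is exactly the conjunction of the one-sided rows. -/
theorem M1EnergyRow_iff (U : ℝ) (lo hi : ℚ) :
    M1EnergyRow U lo hi ↔ M1EnergyLowerRow U lo ∧ M1EnergyUpperRow U hi := Iff.rfl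

/-- M1 doped-chain energy rows at rational filling `n = p/q` (density-`n` TL object of record:
`hubbardChainEnergyDensityAt 1 U p q` = lim_m E₀(ring q·m, N = p·m)/(q·m), p233958; BOARD D-13 r17: a LOWER row is transported
from a certificate by ring-wise feasibility via `hubbardChainEnergyDensityAt_ge_of_frequently_ge`, an UPPER row via
`hubbardChainEnergyDensityAt_le_of_le`). Today's doped rows are `p = 1, q = 2`. -/
def M1DopedEnergyLowerRow (U : ℝ) (p q : ℕ) (lo : ℚ) : Prop :=
  ((lo : ℚ) : ℝ) ≤ hubbardChainEnergyDensityAt 1 U p q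

/-- M1 doped-chain UPPER energy row at filling `p/q`: `e(p/q; U) ≤ hi` (transport `hubbardChainEnergyDensityAt_le_of_le`). -/
def M1DopedEnergyUpperRow (U : ℝ) (p q : ℕ) (hi : ℚ) : Prop :=
  hubbardChainEnergyDensityAt 1 U p q ≤ ((hi : ℚ) : ℝ)

/-- Two-sided M1 doped-chain energy row = lower ∧ upper. -/
def M1DopedEnergyRow (U : ℝ) (p q : ℕ) (lo hi : ℚ) : Prop :=
  M1DopedEnergyLowerRow U p q lo ∧ M1DopedEnergyUpperRow U p q hi

/-- At half filling (`p = q = 1`) the doped object IS the M1 object (`hubbardChainEnergyDensityAt_one_one`). -/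
theorem M1DopedEnergyLowerRow_one_one_iff {U : ℝ} (hU : 0 ≤ U) (lo : ℚ) :
    M1DopedEnergyLowerRow U 1 1 lo ↔ M1EnergyLowerRow U lo := by
  simp [M1DopedEnergyLowerRow, M1EnergyLowerRow, hubbardChainEnergyDensityAt_one_one 1 hU]


/-- M1 tolerance OF RECORD: bracket width at most `1e-3 · t` (coordinator ruling 2026-08-20T19:52Z adopting tribunal T1;
decidable on the rational slots). -/
def M1Width (lo hi : ℚ) : Prop := hi - lo ≤ 1 / 1000

/-- Decidability of this rational-slot predicate (by `inferInstanceAs`; lets `decide`/`norm_num` close instances). -/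
instance (lo hi : ℚ) : Decidable (M1Width lo hi) := inferInstanceAs (Decidable (hi - lo ≤ 1 / 1000))

/-- M1 STRETCH target: bracket width at most `1e-4 · t` (v0's tolerance; reported against, never required). -/
def M1WidthStretch (lo hi : ℚ) : Prop := hi - lo ≤ 1 / 10000

/-- Decidability of this rational-slot predicate (by `inferInstanceAs`; lets `decide`/`norm_num` close instances). -/
instance (lo hi : ℚ) : Decidable (M1WidthStretch lo hi) := inferInstanceAs (Decidable (hi - lo ≤ 1 / 10000))

/-- Meeting the stretch target meets the tolerance of record. -/
theorem M1Width_of_stretch {lo hi : ℚ} (h : M1WidthStretch lo hi) : M1Width lo hi :=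
  le_trans (show hi - lo ≤ 1 / 10000 from h) (by norm_num)

/-- M2 reporting threshold: two-sided TL energy bracket width at most `0.02 · t` (tribunal T1 proposal, adopted as the
cell's working target, VENTURE-STATEMENT R-10; a threshold on the slots, not a claim). -/
def M2Width (lo hi : ℚ) : Prop := hi - lo ≤ 1 / 50

/-- Decidability of this rational-slot predicate (by `inferInstanceAs`; lets `decide`/`norm_num` close instances). -/
instance (lo hi : ℚ) : Decidable (M2Width lo hi) := inferInstanceAs (Decidable (hi - lo ≤ 1 / 50))

/-- M3′ reporting threshold: two-sided e₀ bracket width at the canonical doped point at most `0.05 · t` (tribunal T1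
retarget M3′, adopted R-10; a threshold on the slots, not a claim). -/
def M3Width (lo hi : ℚ) : Prop := hi - lo ≤ 1 / 20

/-- Decidability of this rational-slot predicate (by `inferInstanceAs`; lets `decide`/`norm_num` close instances). -/
instance (lo hi : ℚ) : Decidable (M3Width lo hi) := inferInstanceAs (Decidable (hi - lo ≤ 1 / 20))

/-- M1 "reproduces Lieb–Wu": the Lieb–Wu energy `e_LW(U)` lies in the bracket. Stated, never asserted;
DERIVED from `M1EnergyRow` under the tree's named fact `lieb_wu` (`M1ReproducesLiebWu_of_row`). -/
def M1ReproducesLiebWu (U : ℝ) (lo hi : ℚ) : Prop :=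
  ((lo : ℚ) : ℝ) ≤ liebWuEnergy U ∧ liebWuEnergy U ≤ ((hi : ℚ) : ℝ)

/-- Under `lieb_wu` an M1 energy row at `U > 0` reproduces Lieb–Wu (R-3: the Arb-ball check is then a
consequence, and a failure is an EVENT). -/
theorem M1ReproducesLiebWu_of_row (hlw : lieb_wu) {U : ℝ} (hU : 0 < U) {lo hi : ℚ}
    (h : M1EnergyRow U lo hi) : M1ReproducesLiebWu U lo hi := by
  obtain ⟨h1, h2⟩ := h
  rw [hubbardChainEnergyDensity_eq_liebWuEnergy hlw hU] at h1 h2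
  exact ⟨h1, h2⟩

/-- M2 energy row: certified bracket for the 2D square-lattice Hubbard model at half filling (t = 1),
thermodynamic limit `energyDensity2D 1 U 1` (LEAN-MAP §2.1). -/
def M2EnergyRow (U : ℝ) (lo hi : ℚ) : Prop :=
  ((lo : ℚ) : ℝ) ≤ energyDensity2D 1 U 1 ∧ energyDensity2D 1 U 1 ≤ ((hi : ℚ) : ℝ)

/-- One-sided M2 energy rows (same TL object as `M2EnergyRow`). -/
def M2EnergyLowerRow (U : ℝ) (lo : ℚ) : Prop := ((lo : ℚ) : ℝ) ≤ energyDensity2D 1 U 1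

/-- M2 UPPER energy row: `e₀(2D, U, n = 1) ≤ hi`. -/
def M2EnergyUpperRow (U : ℝ) (hi : ℚ) : Prop := energyDensity2D 1 U 1 ≤ ((hi : ℚ) : ℝ)

/-- The two-sided M2 row is exactly the conjunction of the one-sided rows. -/
theorem M2EnergyRow_iff (U : ℝ) (lo hi : ℚ) :
    M2EnergyRow U lo hi ↔ M2EnergyLowerRow U lo ∧ M2EnergyUpperRow U hi := Iff.rfl


/-- The M2 falsification test as a decidable Prop: the printed reference value lies inside the bracket
(two instances `ref − err`, `ref + err` per row; the reference and its page are cited in the instance). -/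
def RefInside (lo hi ref : ℚ) : Prop := lo ≤ ref ∧ ref ≤ hi

/-- Decidability of this rational-slot predicate (by `inferInstanceAs`; lets `decide`/`norm_num` close instances). -/
instance (lo hi ref : ℚ) : Decidable (RefInside lo hi ref) := inferInstanceAs (Decidable (lo ≤ ref ∧ ref ≤ hi))

/-- M3 energy row at the canonical point `U = 8`, `n = 7/8`, next-nearest-neighbour hopping `tp`
(`tp = 0` or `tp = -1/4`): bracket for `energyDensityTT' 1 tp 8 (7/8)` (LEAN-MAP §3.1; at `tp = 0` this
is `energyDensity2D 1 8 (7/8)` by `energyDensityTT'_zero`). -/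
def M3EnergyRow (tp : ℝ) (lo hi : ℚ) : Prop :=
  ((lo : ℚ) : ℝ) ≤ energyDensityTT' 1 tp 8 (7 / 8) ∧ energyDensityTT' 1 tp 8 (7 / 8) ≤ ((hi : ℚ) : ℝ)

/-- At `tp = 0` the M3 energy row is a bracket on `energyDensity2D 1 8 (7/8)` (`energyDensityTT'_zero`). -/
theorem M3EnergyRow_zero_iff (lo hi : ℚ) :
    M3EnergyRow 0 lo hi ↔
      ((lo : ℚ) : ℝ) ≤ energyDensity2D 1 8 (7 / 8) ∧ energyDensity2D 1 8 (7 / 8) ≤ ((hi : ℚ) : ℝ) := by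
  simp [M3EnergyRow, energyDensityTT'_zero]

/-- One-sided M3 energy rows at the canonical point (same TL object as `M3EnergyRow`; `tp ∈ {0, -1/4}`). -/
def M3EnergyLowerRow (tp : ℝ) (lo : ℚ) : Prop := ((lo : ℚ) : ℝ) ≤ energyDensityTT' 1 tp 8 (7 / 8)

/-- M3 UPPER energy row at the canonical point: `e₀(U = 8, n = 7/8, tp) ≤ hi`. -/
def M3EnergyUpperRow (tp : ℝ) (hi : ℚ) : Prop := energyDensityTT' 1 tp 8 (7 / 8) ≤ ((hi : ℚ) : ℝ)

/-- The two-sided M3 row is exactly the conjunction of the one-sided rows. -/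
theorem M3EnergyRow_iff (tp : ℝ) (lo hi : ℚ) :
    M3EnergyRow tp lo hi ↔ M3EnergyLowerRow tp lo ∧ M3EnergyUpperRow tp hi := Iff.rfl

/-- At `tp = 0` the M3 lower row is a lower bound on `energyDensity2D 1 8 (7/8)`. -/
theorem M3EnergyLowerRow_zero_iff (lo : ℚ) :
    M3EnergyLowerRow 0 lo ↔ ((lo : ℚ) : ℝ) ≤ energyDensity2D 1 8 (7 / 8) := by
  simp [M3EnergyLowerRow, energyDensityTT'_zero]


/-! ## §S — correlator and falsification rows (scribe; binder shapes copied from the tree, see the change log)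

Energy hypothesis `e₀ ≤ u` is EXPLICIT in every correlator row (D-4): `u` is the exact rational of a CERTIFIED upper bound
(its certificate is cited in the instance docstring); a row whose `u` comes from `liebWuEnergy` additionally carries `lieb_wu`
at the use site, never here. `q` is the certificate's claimed constant. Nothing below is asserted. -/

open Literature.Probability.LatticeModels
open Filter Topology HubbardWave0 Literature.MathematicalPhysics.QuantumManyBody.StateRelaxation
open scoped Matrix

/-- Double occupancy `n_{0↑} n_{0↓}` at the origin of `ℤ^d` as a window operator on the support `{0}`
(the substrate's docc word, `sdp_corr_TL_*_Dlo/_Dup`). -/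
def doccAt0 (d : ℕ) : FermionOp ({0} : Finset (Site d)) :=
  nAt 0 (Finset.mem_singleton_self (0 : Site d)) 0 * nAt 0 (Finset.mem_singleton_self (0 : Site d)) 1

/-- §S1 (M1 correlators, LOWER form). Hubbard chain `ℤ`, `t = 1`, coupling `U`, half filling: for every torus-limit
ground state `ω` (weak-* limit of normalised `L`-particle ground states of the even rings `ℤ/Lℤ`), GIVEN
`hubbardChainEnergyDensity 1 U ≤ u`, the window observable `X` on the finite support `Λ` has `q ≤ Re ω(X)`.
Verbatim binder shape of the substrate claim nodes `sdp_corr_TL_hubTL_*` (soundness: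
`InfVolFermionState.IsTorusLimitOf.re_expect_ge_of_chain_window_certificate_ineq`). -/
def ChainCorrLowerRow (U : ℝ) (u q : ℚ) (Λ : Finset (Site 1)) (X : FermionOp Λ) : Prop :=
  ∀ (ω : InfVolFermionState 1) (Ls : ℕ → ℕ) (ψ : ∀ L, Fock (Orb (FermionTorus 1 L))),
    Tendsto Ls atTop atTop → (∀ j, Even (Ls j)) →
    (∀ j, IsGroundState (hamiltonian (fermionTorusGraph 1 (Ls j)) 1 U) (Ls j) (ψ (Ls j))) →
    (∀ j, star (ψ (Ls j)) ⬝ᵥ ψ (Ls j) = 1) → ω.IsTorusLimitOf ψ Ls →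
    ThermodynamicLimit.hubbardChainEnergyDensity 1 U ≤ ((u : ℚ) : ℝ) →
    ((q : ℚ) : ℝ) ≤ (ω.expect Λ X).re

/-- §S1 (UPPER form): same state class and energy hypothesis, conclusion `Re ω(X) ≤ q`. -/
def ChainCorrUpperRow (U : ℝ) (u q : ℚ) (Λ : Finset (Site 1)) (X : FermionOp Λ) : Prop :=
  ∀ (ω : InfVolFermionState 1) (Ls : ℕ → ℕ) (ψ : ∀ L, Fock (Orb (FermionTorus 1 L))),
    Tendsto Ls atTop atTop → (∀ j, Even (Ls j)) →
    (∀ j, IsGroundState (hamiltonian (fermionTorusGraph 1 (Ls j)) 1 U) (Ls j) (ψ (Ls j))) →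
    (∀ j, star (ψ (Ls j)) ⬝ᵥ ψ (Ls j) = 1) → ω.IsTorusLimitOf ψ Ls →
    ThermodynamicLimit.hubbardChainEnergyDensity 1 U ≤ ((u : ℚ) : ℝ) →
    (ω.expect Λ X).re ≤ ((q : ℚ) : ℝ)

/-- M1 docc rows (cells `M1-docc-U<U>-n1`): `q ≤ ω(n_{0↑}n_{0↓})` resp. `ω(n_{0↑}n_{0↓}) ≤ q` given `e₀(U) ≤ u`. -/
def M1DoccLowerRow (U : ℝ) (u q : ℚ) : Prop := ChainCorrLowerRow U u q {0} (doccAt0 1)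
/-- M1 double-occupancy UPPER row at the origin of the chain (energy hypothesis explicit, D-4). -/
def M1DoccUpperRow (U : ℝ) (u q : ℚ) : Prop := ChainCorrUpperRow U u q {0} (doccAt0 1)

/-- M1 nearest-neighbour spin rows (cells `M1-spin_nn-U<U>-n1`): the operator word `X` for `𝐒₀·𝐒₁` on its two-site support is
SUPPLIED BY THE INSTANCE from the op-layer / m1-5 dictionary (one normalisation, LEAN-MAP §1.5) — D1 request; until then the
row is the generic `ChainCorrLowerRow/UpperRow` with that word. -/
def M1SpinNNLowerRow (U : ℝ) (u q : ℚ) (Λ : Finset (Site 1)) (SdotS : FermionOp Λ) : Prop := ChainCorrLowerRow U u q Λ SdotS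

/-- §S2 (M2 correlators, LOWER form). Square lattice `ℤ²`, `t = 1`, coupling `U`, half filling: for every torus-limit ground
state `ω` of the even `L×L` tori, GIVEN `energyDensity2D 1 U 1 ≤ u`, `q ≤ Re ω(X)`. Verbatim binder shape of
`sdp_corr_TL_hubSQ_*` (soundness: `InfVolFermionState.IsTorusLimitOf.re_expect_ge_of_window_certificate_d4_ineq`). -/
def SquareCorrLowerRow (U : ℝ) (u q : ℚ) (Λ : Finset (Site 2)) (X : FermionOp Λ) : Prop :=
  ∀ (ω : InfVolFermionState 2) (Ls : ℕ → ℕ) (ψ : ∀ L, Fock (Orb (FermionTorus 2 L))),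
    Tendsto Ls atTop atTop → (∀ j, Even (Ls j)) →
    (∀ j, IsGroundState (hamiltonian (fermionTorusGraph 2 (Ls j)) 1 U) (Ls j ^ 2) (ψ (Ls j))) →
    (∀ j, star (ψ (Ls j)) ⬝ᵥ ψ (Ls j) = 1) → ω.IsTorusLimitOf ψ Ls →
    ThermodynamicLimit.energyDensity2D 1 U 1 ≤ ((u : ℚ) : ℝ) →
    ((q : ℚ) : ℝ) ≤ (ω.expect Λ X).re

/-- §S2 (UPPER form). -/
def SquareCorrUpperRow (U : ℝ) (u q : ℚ) (Λ : Finset (Site 2)) (X : FermionOp Λ) : Prop :=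
  ∀ (ω : InfVolFermionState 2) (Ls : ℕ → ℕ) (ψ : ∀ L, Fock (Orb (FermionTorus 2 L))),
    Tendsto Ls atTop atTop → (∀ j, Even (Ls j)) →
    (∀ j, IsGroundState (hamiltonian (fermionTorusGraph 2 (Ls j)) 1 U) (Ls j ^ 2) (ψ (Ls j))) →
    (∀ j, star (ψ (Ls j)) ⬝ᵥ ψ (Ls j) = 1) → ω.IsTorusLimitOf ψ Ls →
    ThermodynamicLimit.energyDensity2D 1 U 1 ≤ ((u : ℚ) : ℝ) →
    (ω.expect Λ X).re ≤ ((q : ℚ) : ℝ)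

/-- M2 docc rows (n = 1): `q ≤ ω(n_{0↑}n_{0↓})` given `e₀ ≤ u`. -/
def M2DoccLowerRow (U : ℝ) (u q : ℚ) : Prop := SquareCorrLowerRow U u q {0} (doccAt0 2)
/-- M2 double-occupancy UPPER row at the origin of `ℤ²` (energy hypothesis explicit, D-4). -/
def M2DoccUpperRow (U : ℝ) (u q : ℚ) : Prop := SquareCorrUpperRow U u q {0} (doccAt0 2)

/-- §S3 (M3 correlators = FINITE-TORUS ORBIT-STATE rows; D-8 last bullet, LEAN-MAP §3.4: no torus-limit soundness theorem exists
at `n ≠ 1` / `t′ ≠ 0`). `L×L` torus, `t = 1`, next-nearest-neighbour hopping `tp`, `U = 8`, sector `(2·nh, S^z = 0)`: for EVERY unit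
ground state `ψ` of the sector, GIVEN the per-site energy hypothesis `groundEnergy/L² ≤ u`, the symmetry-averaged (orbit-state over the
subgroup generated by `S ⊆ D₄` and translations) expectation of the window operator `Xw` (support `Λ'`, embedded in the torus by
`PolySite.toTorusEmb L hInj'`) is `≥ q`. Conclusion shape of `re_orbitState_ge_of_window_certificate_d4_TT'_groundState`. The canonical
point is `U = 8`, `nh/L² = 7/16` (n = 7/8), `tp ∈ {0, -1/4}`; pairing / stripe words `Xw` from the m3-1/m3-2 operator sets. -/
def M3TorusCorrLowerRow (tp : ℝ) (L : ℕ) [NeZero L] (nh : ℕ) (u q : ℚ) (Λ' : Finset (Site 2))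
    (hInj' : Set.InjOn (Torus.proj (d := 2) L) ↑Λ') (S : Finset (DihedralGroup 4)) (Xw : FermionOp Λ') : Prop :=
  ∀ ψ : Fock (Orb (FermionTorus 2 L)),
    IsGroundStateInSector (hubbardTorusTT' L 1 tp 8) (2 * nh) 0 ψ → star ψ ⬝ᵥ ψ = 1 →
    groundEnergy (hubbardTorusTT' L 1 tp 8) (2 * nh) / (L : ℝ) ^ 2 ≤ ((u : ℚ) : ℝ) →
    ((q : ℚ) : ℝ) ≤ (orbitState (spaceGroupUnitary S) ψ (fermionEmbed (PolySite.toTorusEmb L hInj') Xw)).re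

/-- Falsification test with an error bar (REFVALS FR-1 shape, decidable on the slots): the printed interval `[ref − err, ref + err]`
MEETS the certified bracket `[lo, hi]` (PASS iff non-empty intersection; the z-score grading lives in falsify.py, not here). -/
def RefIntervalMeets (lo hi ref err : ℚ) : Prop := lo ≤ ref + err ∧ ref - err ≤ hi

/-- Decidability of this rational-slot predicate (by `inferInstanceAs`; lets `decide`/`norm_num` close instances). -/
instance (lo hi ref err : ℚ) : Decidable (RefIntervalMeets lo hi ref err) :=
  inferInstanceAs (Decidable (lo ≤ ref + err ∧ ref - err ≤ hi))

/-- Stronger form: the whole printed interval lies INSIDE the bracket. -/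
def RefIntervalInside (lo hi ref err : ℚ) : Prop := lo ≤ ref - err ∧ ref + err ≤ hi

/-- Decidability of this rational-slot predicate (by `inferInstanceAs`; lets `decide`/`norm_num` close instances). -/
instance (lo hi ref err : ℚ) : Decidable (RefIntervalInside lo hi ref err) :=
  inferInstanceAs (Decidable (lo ≤ ref - err ∧ ref + err ≤ hi))

/-! ## Errata to the module docstring (append-only follow-up, 2026-08-20, venture lead gen-4; BOARD D-16 r32)

Two WORDING errata found by the literature cross-read of every printed number in STATEMENT v1 against the
primaries (sr-mbsolver seat lit-3, REFVALS.md ADDITIONS gen-4 §X.v1/§M3.i). No declaration, number, tolerance,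
yardstick or verdict sentence of this file changes; the text above is kept verbatim as the v1 record and is to be
READ WITH these two corrections (STATEMENT-DRAFT-v1.1.md in run/shared/lean/pub/pub-mbsolver/ carries them inline).

* E1 (§Ladder v1, rung M3′(a)): "the best printed floating-point SDP lower bound, Han 2020 K = 7, which sits
  0.10·t above e₀" should read: "the best printed floating-point SDP lower bound — Han 2020 (arXiv:2006.06002),
  K = 7, t′ = 0: −0.867, i.e. 0.10·t BELOW e₀ ≈ −0.767 (a lower bound lies below the energy); no printed SDP
  bound of any kind exists at t′ = −1/4".
* E2 (§Ladder v1 HORIZON; §Barriers `PureModelStripeCompetition`): "split by 0.0005–0.009·t (uniform d-wave vs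
  filled stripe ≈ 0.009·t; …; arXiv:1701.00054 p.4–5 …)" should read: "split by 0.0005–0.01·t (uniform d-wave
  vs filled stripe ≈ 0.01·t [arXiv:1701.00054 p.4; SM Tab. S1: 0.009–0.013·t by method]; diagonal vs vertical
  stripe 0.009·t [ibid. p.5]; stripe wavelengths λ = 5…8 within 0.0005–0.004·t [ibid. p.5, SM Tab. S1];
  2/3-filled vs filled stripe ∼0.001·t [arXiv:1910.08931 p.8, App. D Fig. 19])"; wherever the range
  0.0005–0.009·t is quoted as the source of the 0.005·t yardstick, read 0.0005–0.01·t. The DAY-7 yardstick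
  0.005·t (HORIZON; not a predicate of this file) is unchanged — it lies inside the corrected range exactly as before.
-/

end Summit.Ventures.CertifiedManyBodySolver

end
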